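import Literature.NumberTheory.Automorphic.Liu2021.LemD1AsPrintedIndexedNonVacuityInertSign
import HarnessLib

/-!
# [Liu2021, App. D Lemma D.1 (1) ∧ (3)] AS PRINTED, JOINTLY, with TWO μ-labels at EVERY place `∤ 2` of the place model —
# the non-split places included (`N` odd `≥ 3`): the TAME CARRIER CHARACTER `Λ = θ_w ∘ det_w` of `U(V)(F_v)`

Reproduction ∕ bookkeeping (Literature, THEOREMS ONLY: no definition, no record, no named fact, no `sorry`; nothing is
asserted about Liu's oscillator representations or about the tree's constructed local Weil carriers).

Sequel of `LemD1AsPrintedIndexedNonVacuityTameTwist.lean` (the tame character `θ_w` of `E_wˣ` at `w ∤ 2`, `θ_w(−1) = −1`; the second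
Step-2 datum `μ' = μ · χ`), of `…InertSign.lean` (the unramified sign character: a Step-2 datum at every inert place of ANY quadratic
`E/F`) and of `…AtPlace.lean` §4–§6 (at a SPLIT place: the carrier character `ν_w ∘ det ∘ pr_w` and the joint certificate «(1) for every
member ∧ (3)» with `μ₀ = 1 ≠ μ₁`; `…NonsplitPlace.lean` named «no two-`μ`-label (1) ∧ (3) collection at a non-split place»).
Setting: the tree's place model of a quadratic `E/F` at a finite place `v` (`F_v`, `E_v = Π_{w∣v} E_w`, `c ⊗ 1`, `c δ = −δ ≠ 0`, the
standing data `S = LemD1OfPlace.standingData …` with `U(V)(F_v) = S.U ≤ GL_N(E_v)`, centre `E_v¹ = S.normOne`, `S.scalar`), a place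
`w ∣ v` with `w ∤ 2` (split OR not), and `N` ODD.

* §1 generic (private copies of the siblings' lemmas): a line on which `S.U` acts through a character `λ` agreeing with `χ` on the
  centre has trivial `χ`-augmentation; two such lines with `λ₁(g₀) ≠ λ₀(g₀)` have NON-isomorphic `χ`-quotients; [Lem. D.1, first
  sentence + (1)] AS PRINTED holds at a character datum of rank `≠ 2` (both sides of (1) false).
* §2 **`exists_tame_carrier_character`**: the character `Λ(g) = θ_w(det(g)_w)` of `S.U` and the Step-3 character
  `χ_Λ(z) = θ_w(z_w)^N ∈ ChiSet S`, with `Λ ∘ S.scalar = χ_Λ` (`det(z · 1_N) = z^N`), `Λ = 1` on the open neighbourhood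
  `{g : v_w(det(g)_w − 1) < 1}` of `1` (`θ_w` is trivial on `1 + 𝔭_w`), and `Λ(−1 · 1_N) = χ_Λ(−1) = θ_w(−1)^N = −1` (`N` odd,
  `−1 ∈ E_v¹`).
* §3 **`exists_lemD1IndexedFamily_item1_and_lemD1_3_twist`** (`N` odd `≥ 3`, any `μ ∈ MuSet S`, any representative `e`): the two-member
  collection `(μ, e, 1; trivial line)`, `(μ', e, χ_Λ; line of Λ)` — `μ'` the tame twist, `μ'(ε) = −μ(ε)` — satisfies [Lem. D.1, first
  sentence + (1)] AS PRINTED member by member AND [Lem. D.1 (3)] AS PRINTED for all four pairs (`ω₁ ≇ ω₀` and the labels differ), with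
  `Lf.mu 0 ≠ Lf.mu 1` (and `Lf.chi 0 ≠ Lf.chi 1`); **`exists_lemD1IndexedFamily_item1_and_lemD1_3_chi`**: the same with labels
  `(μ, e, 1)`, `(μ, e, χ_Λ)` — the `χ`-slot ALONE separating; **`not_forall_mu_eq_twist`**: at every place `∤ 2` carrying a Step-2 datum
  the two displayed records do not force «all members carry the same `μ`» (tree so far: split places, `…AtPlace.not_forall_mu_eq_of_split`);
  **`not_forall_mu_eq_of_inertWitness`**: hypothesis-free at an inert place `∤ 2` of ANY quadratic `E/F` (`…InertSign`).
* §4 the CM rows (`L` CM, `F = L⁺`, `δ = imagUnit L`, rows' own `μ_v = localMu L (toHeckeCharacter L ψ) v`, `ψ` conjugate symplectic):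
  both certificates with `μ_v` — packaged by `LemD1OfPlace.muOf` with VERBATIM the displayed proofs — as member `0`
  (`exists_lemD1IndexedFamily_item1_and_lemD1_3_localMu_twist`, `…_localMu_chi`), and `not_forall_mu_eq_of_isCMField` at EVERY place
  `v ∤ 2` of `L⁺`, `N` odd `≥ 3`.

What this does NOT give: `N` even (then `Λ(−1 · 1_N) = 1`; a witness of order `> 2` for `θ_w` on `E_w¹`, e.g. through the residue
field of `E_w` at an inert place, is not constructed); a two-member model in which (3) holds and ONLY the μ-slot separates (needs two
non-isomorphic carriers with the SAME central character); places above `2`; anything about the rows' OWN carriers `𝓢.omegaLoc v`; Lem.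
D.1 itself.  HC_CM is NOT proved.

Cell pub-hodgecm2 (COR-CM), audit class of the END rows `hD1''` ∕ `hD3`; seat prover-pub-hodgecm2-b10.

References: [Liu2021] Y. Liu, *Fourier–Jacobi cycles and arithmetic relative trace formula*, Camb. J. Math. 9 (2021) =
arXiv:2102.11518, App. D §D.1 Steps 1–3 (`FJcycle.tex` l. 5217–5221; arXiv p. 56 L8–L16), Lemma D.1 (1) (l. 5229), (3) (l. 5233),
Def. 4.11 (l. 2086); [NeukirchANT1999] Ch. II §5 Prop. (5.3) (the tame character); [Mok2014] C. P. Mok, Mem. AMS 235 (2015), §1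
Notation p. 5 (`U(J)(F_v)`).
-/

noncomputable section

open scoped Matrix MatrixGroups
open NumberField IsDedekindDomain
open Literature.RepresentationTheory
open Literature.RepresentationTheory.Liu2021 (OscillatorStandingData)
open Literature.RepresentationTheory.CentralCharacterQuotient (augmentation quotRep quotRep_mk)
open Literature.NumberTheory.GaloisRepresentations (HeckeCharacter)

namespace Literature.NumberTheory.Automorphic.Liu2021.LemD1IndexedNonVacuityTameCarrier

open UnitaryGroup

/-! ## §1 Generic: character carriers, their `χ`-quotients, (1) at rank `≠ 2`, non-isomorphism -/

section Generic

/-- For a datum whose carrier is the line `ℂ` with `U(V)(F)` acting through a character `λ` that agrees with `χ` on the centre,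
the `χ`-augmentation submodule vanishes (copy of the private lemma of `LemD1IndexedNonVacuityAtPlace`). [folklore] -/
private theorem augmentation_eq_bot_of_character {F₀ E₀ : Type} [Field F₀] [ValuativeRel F₀] [TopologicalSpace F₀]
    [CommRing E₀] [Algebra F₀ E₀] [TopologicalSpace E₀] {n : ℕ} (L : LemD1Data F₀ E₀ n ℂ) (lam : L.S.U →* ℂˣ)
    (hω : ∀ (g : L.S.U) (x : ℂ), L.omega g x = (lam g : ℂ) * x)
    (hcen : ∀ z : L.S.normOne, lam (L.S.scalar z) = L.chi z) :
    augmentation L.omega L.S.scalar L.chi = ⊥ := by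
  unfold augmentation
  refine iSup_eq_bot.2 fun z => ?_
  rw [LinearMap.range_eq_bot]
  ext
  simp [hω, hcen]

/-- Two lines on which a group acts through characters `λ₁` and `λ₀` with `λ₁ g₀ ≠ λ₀ g₀` for some `g₀` have NON-isomorphic maximal
`χ`-quotients (the first quotient being the line itself).  Variant of the private lemma of `LemD1IndexedNonVacuityAtPlace` with a
non-trivial `λ₀`. [folklore] -/
private theorem not_areIsomorphicRep_quotRep_of_characters {G Z : Type*} [Group G] [Group Z]
    (ρ₁ ρ₀ : Representation ℂ G ℂ) {ζ : Z →* G} (hζ : ∀ z, ζ z ∈ Subgroup.center G) (χ₁ χ₀ : Z →* ℂˣ)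
    (lam₁ lam₀ : G →* ℂˣ) (h₁ : ∀ (g : G) (x : ℂ), ρ₁ g x = (lam₁ g : ℂ) * x) (h₀ : ∀ (g : G) (x : ℂ), ρ₀ g x = (lam₀ g : ℂ) * x)
    (hN₁ : augmentation ρ₁ ζ χ₁ = ⊥) {g₀ : G} (hg₀ : lam₁ g₀ ≠ lam₀ g₀) :
    ¬ AreIsomorphicRep (quotRep ρ₁ hζ χ₁) (quotRep ρ₀ hζ χ₀) := by
  rintro ⟨f, hf⟩
  have hw0 : (Submodule.Quotient.mk 1 : ℂ ⧸ augmentation ρ₁ ζ χ₁) ≠ 0 := by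
    rw [Ne, Submodule.Quotient.mk_eq_zero, hN₁, Submodule.mem_bot]
    exact one_ne_zero
  have h1 : quotRep ρ₁ hζ χ₁ g₀ (Submodule.Quotient.mk 1) =
      (lam₁ g₀ : ℂ) • (Submodule.Quotient.mk 1 : ℂ ⧸ augmentation ρ₁ ζ χ₁) := by
    rw [quotRep_mk, h₁, ← smul_eq_mul, Submodule.Quotient.mk_smul]
  have h2 : ∀ y : ℂ ⧸ augmentation ρ₀ ζ χ₀, quotRep ρ₀ hζ χ₀ g₀ y = (lam₀ g₀ : ℂ) • y := by
    intro y
    obtain ⟨u, rfl⟩ := Submodule.Quotient.mk_surjective _ y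
    rw [quotRep_mk, h₀, ← smul_eq_mul, Submodule.Quotient.mk_smul]
  have key := hf g₀ (Submodule.Quotient.mk 1)
  rw [h1, h2, map_smul] at key
  have hsub : ((lam₁ g₀ : ℂ) - lam₀ g₀) • f (Submodule.Quotient.mk 1) = 0 := by
    rw [sub_smul, key, sub_self]
  rcases smul_eq_zero.1 hsub with h | h
  · exact hg₀ (Units.ext (sub_eq_zero.1 h))
  · exact hw0 (f.injective (by rw [h, map_zero]))

/-- **Item (1) AS PRINTED holds at a character datum of rank `n ≠ 2`** (copy of the private lemma of the siblings).
[cite: Liu2021, App. D Lemma D.1 (1) (l. 5229)] -/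
private theorem lemD1_1AsPrinted_of_character_of_rank_ne_two' {F₀ E₀ : Type} [Field F₀] [ValuativeRel F₀]
    [TopologicalSpace F₀] [CommRing E₀] [Algebra F₀ E₀] [TopologicalSpace E₀] [IsTopologicalRing E₀] {n₀ : ℕ}
    (L : LemD1Data F₀ E₀ n₀ ℂ) (lam : L.S.U →* ℂˣ) (hω : ∀ (g : L.S.U) (x : ℂ), L.omega g x = (lam g : ℂ) * x)
    (hcen : ∀ z : L.S.normOne, lam (L.S.scalar z) = L.chi z)
    (hopen : ∃ O : Set L.S.U, IsOpen O ∧ (1 : L.S.U) ∈ O ∧ ∀ g ∈ O, lam g = 1) (hn : n₀ ≠ 2) :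
    LemD1_1AsPrinted L := by
  have hN : augmentation L.omega L.S.scalar L.chi = ⊥ := augmentation_eq_bot_of_character L lam hω hcen
  have hfin : Module.finrank ℂ (ℂ ⧸ augmentation L.omega L.S.scalar L.chi) = 1 := by
    rw [(Submodule.quotEquivOfEqBot _ hN).finrank_eq, Module.finrank_self]
  haveI hsimple : IsSimpleModule ℂ (ℂ ⧸ augmentation L.omega L.S.scalar L.chi) :=
    isSimpleModule_iff_finrank_eq_one.2 hfin
  have hact : ∀ (g : L.S.U) (w : ℂ ⧸ augmentation L.omega L.S.scalar L.chi),
      L.datum.quot g w = (lam g : ℂ) • w := by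
    intro g w
    obtain ⟨y, rfl⟩ := Submodule.Quotient.mk_surjective _ w
    rw [LemD1Data.datum_quot, quotRep_mk, hω, ← smul_eq_mul, Submodule.Quotient.mk_smul]
  refine ⟨⟨?_, ?_, ?_⟩, ?_⟩
  · intro W
    rcases eq_bot_or_eq_top W.toSubmodule with h | h
    · exact Or.inl (Subrepresentation.toSubmodule_injective h)
    · exact Or.inr (Subrepresentation.toSubmodule_injective h)
  · intro x
    obtain ⟨O, hO, h1O, hlam⟩ := hopen
    change IsOpen (L.datum.quot.stabilizerSubgroup x : Set L.S.U)
    refine Subgroup.isOpen_of_mem_nhds _ (g := 1) (Filter.mem_of_superset (hO.mem_nhds h1O) fun g hg => ?_)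
    change L.datum.quot g x = x
    rw [hact, hlam g hg, Units.val_one, one_smul]
  · intro K _
    infer_instance
  · refine iff_of_false ?_ ?_
    · rw [not_subsingleton_iff_nontrivial]
      exact Module.nontrivial_of_finrank_pos (R := ℂ) (by rw [hfin]; exact one_pos)
    · exact fun h => hn h.2.1.2

/-- A homomorphism with open kernel is locally constant (copy of the tree's private lemma). [folklore] -/
private theorem isLocallyConstant_of_isOpen_ker {Γ G : Type*} [Group Γ] [TopologicalSpace Γ]
    [ContinuousMul Γ] [Group G] (r : Γ →* G) (h : IsOpen (r.ker : Set Γ)) :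
    IsLocallyConstant r := by
  refine (IsLocallyConstant.iff_exists_open r).2 fun σ => ⟨{τ | σ⁻¹ * τ ∈ r.ker}, ?_, ?_, ?_⟩
  · exact h.preimage (continuous_const_mul σ⁻¹)
  · show σ⁻¹ * σ ∈ r.ker
    rw [inv_mul_cancel]; exact r.ker.one_mem
  · intro τ hτ
    have hτ' : r (σ⁻¹ * τ) = 1 := hτ
    rw [map_mul, map_inv, inv_mul_eq_one] at hτ'
    exact hτ'.symm

end Generic

/-! ## §2 The TAME CARRIER CHARACTER `Λ = θ_w ∘ det_w` of `U(V)(F_v)` at every place `w ∤ 2`, `N` odd -/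

section PlaceModel

variable {F : Type} (E : Type) [Field F] [NumberField F] [Field E] [NumberField E] [Algebra F E]
  [Algebra.IsQuadraticExtension F E] (v : HeightOneSpectrum (𝓞 F)) (c : E ≃ₐ[F] E)
  {δ : E} (hcδ : c δ = -δ) (hδ : δ ≠ 0)
  (N : ℕ) (J : Matrix (Fin N) (Fin N) E) (hN : 2 ≤ N) (hJh : (J.map c)ᵀ = J) (hJdet : J.det ≠ 0)

omit [Algebra.IsQuadraticExtension F E] in
/-- the «ball» `{y : v_w(y − 1) < 1}` of `E_w` (the principal units, plus non-units of the ball) is open (ultrametric inequality). [folklore] -/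
private theorem isOpen_setOf_valued_sub_one_lt (w : HeightOneSpectrum (𝓞 E)) :
    IsOpen {y : w.adicCompletion E | Valued.v (y - 1) < 1} := by
  rw [isOpen_iff_mem_nhds]
  intro y hy
  rw [Set.mem_setOf_eq] at hy
  rw [Valued.mem_nhds]
  refine ⟨1, fun z hz => ?_⟩
  have hz' : Valued.v (z - y) < 1 := by
    simpa only [Set.mem_setOf_eq, Units.val_one, Valuation.restrict_lt_one_iff] using hz
  rw [Set.mem_setOf_eq, show z - 1 = (z - y) + (y - 1) by ring]
  exact Valuation.map_add_lt _ hz' hy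

/-- `−1 ∈ E_v¹ = S.normOne` (`(−1) · (c ⊗ 1)(−1) = 1`). [cite: Liu2021, App. D §D.1 Step 3 (l. 5221)] -/
private theorem neg_one_mem_normOne :
    (-1 : (LocalRing E v)ˣ) ∈ (LemD1OfPlace.standingData E v c N J hcδ hδ hN hJh hJdet).normOne := by
  rw [OscillatorStandingData.mem_normOne_iff']
  change ((-1 : (LocalRing E v)ˣ) : LocalRing E v) * conjLocal E c v ((-1 : (LocalRing E v)ˣ) : LocalRing E v) = 1
  rw [Units.val_neg, Units.val_one, map_neg, map_one, neg_mul_neg, one_mul]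

include hcδ in
/-- **the tame carrier character**: at a place `w ∣ v` with `w ∤ 2` and `N` odd there are a character `Λ` of `U(V)(F_v) = S.U`
(`Λ(g) = θ_w(det(g)_w)`, `θ_w` the tame character of `LemD1IndexedNonVacuityTameTwist.exists_tame_character`) and a Step-3 character
`χ_Λ ∈ ChiSet S` (`χ_Λ(z) = θ_w(z_w)^N`, unitary and continuous) such that `Λ` restricted to the centre `E_v¹` along `S.scalar` IS `χ_Λ`
(`det(z · 1_N) = z^N`), `Λ` is trivial on the open neighbourhood `{g : v_w(det(g)_w − 1) < 1}` of `1` (`θ_w` kills `1 + 𝔭_w`), and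
`Λ(−1 · 1_N) = χ_Λ(−1) = θ_w(−1)^N = −1` (`N` odd).  Non-split analogue of `LemD1IndexedNonVacuityAtPlace.exists_carrier_character_of_split`.
[cite: Liu2021, App. D §D.1 Step 3 (l. 5221)] [cite: Mok2014, §1 Notation p. 5] [cite: NeukirchANT1999, Ch. II §5 Prop. (5.3)] -/
theorem exists_tame_carrier_character (w : PlacesOver E v) (h2 : (2 : 𝓞 E) ∉ w.1.asIdeal) (hNo : Odd N) :
    ∃ (Λ : (LemD1OfPlace.standingData E v c N J hcδ hδ hN hJh hJdet).U →* ℂˣ)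
      (χ : LemD1.ChiSet (LemD1OfPlace.standingData E v c N J hcδ hδ hN hJh hJdet)),
      (∀ z : (LemD1OfPlace.standingData E v c N J hcδ hδ hN hJh hJdet).normOne,
        Λ ((LemD1OfPlace.standingData E v c N J hcδ hδ hN hJh hJdet).scalar z) = χ.1 z) ∧
      (∃ O : Set (LemD1OfPlace.standingData E v c N J hcδ hδ hN hJh hJdet).U, IsOpen O ∧ 1 ∈ O ∧ ∀ g ∈ O, Λ g = 1) ∧
      Λ ((LemD1OfPlace.standingData E v c N J hcδ hδ hN hJh hJdet).scalar
        ⟨-1, neg_one_mem_normOne E v c hcδ hδ N J hN hJh hJdet⟩) = -1 ∧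
      χ.1 ⟨-1, neg_one_mem_normOne E v c hcδ hδ N J hN hJh hJdet⟩ = -1 := by
  set S := LemD1OfPlace.standingData E v c N J hcδ hδ hN hJh hJdet with hS
  obtain ⟨θ, hθopen, -, hθnorm, hθprin, hθneg⟩ := LemD1IndexedNonVacuityTameTwist.exists_tame_character w.1 h2
  have hθsq : θ (-1) = -1 := by
    have h1 : θ (-1) ^ 2 = 1 := by rw [← map_pow, neg_one_sq, map_one]
    have h2' : (((θ (-1) : ℂˣ) : ℂ)) ^ 2 = 1 := by rw [← Units.val_pow_eq_pow_val, h1, Units.val_one]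
    rcases sq_eq_one_iff.1 h2' with h | h
    · exact absurd (Units.ext h) hθneg
    · exact Units.ext (by rw [h, Units.val_neg, Units.val_one])
  let prw : (LocalRing E v)ˣ →* (w.1.adicCompletion E)ˣ :=
    Units.map (Pi.evalRingHom (fun w' : PlacesOver E v => w'.1.adicCompletion E) w).toMonoidHom
  have hprw : ∀ y : (LocalRing E v)ˣ, ((prw y : (w.1.adicCompletion E)ˣ) : w.1.adicCompletion E) = (y : LocalRing E v) w :=
    fun y => rfl
  have hθc : Continuous fun x : (LocalRing E v)ˣ => ((θ (prw x) : ℂˣ) : ℂ) :=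
    (Units.continuous_val.comp (isLocallyConstant_of_isOpen_ker θ hθopen).continuous).comp
      (Continuous.units_map _ (continuous_apply w))
  let detU : S.U →* (LocalRing E v)ˣ := Matrix.GeneralLinearGroup.det.comp S.U.subtype
  let Λ : S.U →* ℂˣ := θ.comp (prw.comp detU)
  have hΛ : ∀ g : S.U, Λ g = θ (prw (Matrix.GeneralLinearGroup.det (g : GL (Fin N) (LocalRing E v)))) := fun g => rfl
  let χ₀ : S.normOne →* ℂˣ := (θ.comp (prw.comp S.normOne.subtype)) ^ N
  have hχ₀ : ∀ z : S.normOne, χ₀ z = θ (prw (z : (LocalRing E v)ˣ)) ^ N := fun z => rfl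
  let χ : LemD1.ChiSet S := ⟨χ₀, fun z => by
      rw [hχ₀, Units.val_pow_eq_pow_val, norm_pow, hθnorm, one_pow],
    by
      have : (fun z : S.normOne => ((χ₀ z : ℂˣ) : ℂ)) =
          fun z : S.normOne => (((θ (prw (z : (LocalRing E v)ˣ)) : ℂˣ) : ℂ)) ^ N := by
        funext z; rw [hχ₀, Units.val_pow_eq_pow_val]
      rw [this]
      exact (hθc.comp continuous_subtype_val).pow N⟩
  -- det of a scalar
  have hdet : ∀ z : S.normOne, Matrix.GeneralLinearGroup.det ((S.scalar z : S.U) : GL (Fin N) (LocalRing E v)) =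
      (z : (LocalRing E v)ˣ) ^ N := fun z => by
    apply Units.ext
    rw [Matrix.GeneralLinearGroup.val_det_apply, OscillatorStandingData.coe_scalar, Matrix.scalar_apply, Matrix.det_diagonal,
      Finset.prod_const, Finset.card_univ, Fintype.card_fin, Units.val_pow_eq_pow_val]
  have hcen : ∀ z : S.normOne, Λ (S.scalar z) = χ.1 z := fun z => by
    change Λ (S.scalar z) = χ₀ z
    rw [hΛ, hdet, map_pow, map_pow, hχ₀]
  have hm1 : χ.1 ⟨-1, neg_one_mem_normOne E v c hcδ hδ N J hN hJh hJdet⟩ = -1 := by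
    change χ₀ _ = -1
    rw [hχ₀]
    change θ (prw (-1)) ^ N = -1
    have : prw (-1) = -1 := Units.ext rfl
    rw [this, hθsq, hNo.neg_one_pow]
  refine ⟨Λ, χ, hcen, ?_, by rw [hcen, hm1], hm1⟩
  -- the open neighbourhood of `1` on which `Λ = 1`
  let f : S.U → w.1.adicCompletion E := fun g =>
    (((g : GL (Fin N) (LocalRing E v)) : Matrix (Fin N) (Fin N) (LocalRing E v)).map
      (Pi.evalRingHom (fun w' : PlacesOver E v => w'.1.adicCompletion E) w)).det
  have hf : ∀ g : S.U, f g = ((prw (Matrix.GeneralLinearGroup.det (g : GL (Fin N) (LocalRing E v))) :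
      (w.1.adicCompletion E)ˣ) : w.1.adicCompletion E) := fun g => by
    rw [hprw, Matrix.GeneralLinearGroup.val_det_apply]
    change _ = (Pi.evalRingHom (fun w' : PlacesOver E v => w'.1.adicCompletion E) w)
      (((g : GL (Fin N) (LocalRing E v)) : Matrix (Fin N) (Fin N) (LocalRing E v)).det)
    rw [RingHom.map_det]
    rfl
  have hfc : Continuous f := by
    refine Continuous.matrix_det ?_
    refine Continuous.matrix_map ?_ (continuous_apply w)
    exact Units.continuous_val.comp continuous_subtype_val
  refine ⟨f ⁻¹' {y | Valued.v (y - 1) < 1}, (isOpen_setOf_valued_sub_one_lt E w.1).preimage hfc, ?_, fun g hg => ?_⟩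
  · rw [Set.mem_preimage, Set.mem_setOf_eq, hf, OneMemClass.coe_one, map_one, map_one, Units.val_one, sub_self, map_zero]
    exact one_pos
  · rw [Set.mem_preimage, Set.mem_setOf_eq, hf] at hg
    rw [hΛ]
    exact hθprin _ hg

/-! ## §3 The JOINT certificates «(1) for every member ∧ (3)» at every place `∤ 2`, `N` odd `≥ 3` -/

include hcδ in
/-- **(1) ∧ (3) JOINTLY with TWO μ-labels at EVERY place `∤ 2` (non-split included), `N` odd `≥ 3`** (T5-style in-kernel certificate at
the slot types of the place model): for every element `μ` of the printed Step-2 index set and every representative `e`, the two-member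
collection with labels `(μ, e, 1)` and `(μ', e, χ_Λ)` — `μ'` the tame twist (`μ'(ε) = −μ(ε)`), `χ_Λ(−1) = −1` — and carriers the trivial
line and the line of the tame carrier character `Λ` (§2) satisfies [Lem. D.1, first sentence + (1)] AS PRINTED member by member AND
[Lem. D.1 (3)] AS PRINTED for all four pairs (the two `ω`'s are NON-isomorphic — `Λ(−1 · 1_N) = −1 ≠ 1` — and the labels differ), with
`Lf.mu 0 ≠ Lf.mu 1`, `Lf.chi 0 ≠ Lf.chi 1`.  The tree had such a model only at SPLIT places (`…AtPlace.exists_lemD1IndexedFamily_of_split`).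
[cite: Liu2021, App. D Lemma D.1 (1) and (3) (l. 5229, 5233)] -/
theorem exists_lemD1IndexedFamily_item1_and_lemD1_3_twist (w : PlacesOver E v) (h2 : (2 : 𝓞 E) ∉ w.1.asIdeal) (hNo : Odd N)
    (h3 : 3 ≤ N) (μ : LemD1.MuSet (LemD1OfPlace.standingData E v c N J hcδ hδ hN hJh hJdet))
    (e : LemD1.EpsRep (LemD1OfPlace.standingData E v c N J hcδ hδ hN hJh hJdet)) :
    ∃ Lf : LemD1IndexedFamily (v.adicCompletion F) (LocalRing E v) N (Fin 2),
      Lf.S = LemD1OfPlace.standingData E v c N J hcδ hδ hN hJh hJdet ∧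
      (∀ i, (Lf.eps i).1 = e.1) ∧ (Lf.chi 0).1 = 1 ∧ (Lf.mu 0).1 = μ.1 ∧
      (Lf.mu 1).1 (LemD1OfPlace.eps E v hδ) = -μ.1 (LemD1OfPlace.eps E v hδ) ∧
      Lf.Item1AsPrinted ∧ LemD1_3AsPrintedI Lf ∧ Lf.mu 0 ≠ Lf.mu 1 ∧ Lf.chi 0 ≠ Lf.chi 1 ∧
      ¬ AreIsomorphicRep (Lf.quot 1) (Lf.quot 0) := by
  classical
  obtain ⟨e₁, he₁⟩ := e
  have hN2 : N ≠ 2 := by omega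
  obtain ⟨μ₁, hne, hμ₁, -⟩ := LemD1IndexedNonVacuityTameTwist.exists_muSet_ne_twist E v c hcδ hδ N J hN hJh hJdet w h2 μ
  obtain ⟨Λ, χ₁, hcen, hopen, hΛm1, hχm1⟩ := exists_tame_carrier_character E v c hcδ hδ N J hN hJh hJdet w h2 hNo
  let S := LemD1OfPlace.standingData E v c N J hcδ hδ hN hJh hJdet
  let χ₀ : LemD1.ChiSet S := ⟨1, fun z => by simp, by simpa using continuous_const⟩
  let ω₀ : Representation ℂ S.U ℂ := Representation.trivial ℂ S.U ℂ
  let ω₁ : Representation ℂ S.U ℂ := (DistribMulAction.toModuleEnd ℂ ℂ).comp Λ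
  have hω₀ : ∀ (g : S.U) (x : ℂ), ω₀ g x = ((1 : S.U →* ℂˣ) g : ℂ) * x := fun g x => by
    rw [MonoidHom.one_apply, Units.val_one, one_mul]; rfl
  have hω₁ : ∀ (g : S.U) (x : ℂ), ω₁ g x = (Λ g : ℂ) * x := fun g x => by
    change (Λ g : ℂˣ) • x = _
    rw [Units.smul_def, smul_eq_mul]
  let Lf : LemD1IndexedFamily (v.adicCompletion F) (LocalRing E v) N (Fin 2) :=
    { isNonarchimedeanLocalField := inferInstance
      isModuleTopology := LemD1OfPlace.isModuleTopology_localRing E v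
      S := S
      mu := ![μ, μ₁]
      eps := fun _ => ⟨e₁, he₁⟩
      chi := ![χ₀, χ₁]
      V := fun _ => ℂ
      omega := ![ω₀, ω₁] }
  have hμne : Lf.mu 0 ≠ Lf.mu 1 := fun h => hne h.symm
  have hχne : Lf.chi 0 ≠ Lf.chi 1 := fun h => by
    have h' := congrArg (fun χ : LemD1.ChiSet S => χ.1 ⟨-1, neg_one_mem_normOne E v c hcδ hδ N J hN hJh hJdet⟩) h
    change (1 : S.normOne →* ℂˣ) _ = χ₁.1 _ at h'
    rw [MonoidHom.one_apply, hχm1] at h'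
    have h'' := Units.ext_iff.1 h'
    rw [Units.val_one, Units.val_neg, Units.val_one] at h''
    norm_num at h''
  -- non-isomorphism: `Λ(−1 · 1) = −1 ≠ 1`
  have hN₁ : augmentation (Lf.single 1).omega (Lf.single 1).S.scalar (Lf.single 1).chi = ⊥ :=
    augmentation_eq_bot_of_character (Lf.single 1) Λ hω₁ hcen
  have hg₀ : Λ (S.scalar ⟨-1, neg_one_mem_normOne E v c hcδ hδ N J hN hJh hJdet⟩) ≠
      (1 : S.U →* ℂˣ) (S.scalar ⟨-1, neg_one_mem_normOne E v c hcδ hδ N J hN hJh hJdet⟩) := by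
    rw [hΛm1, MonoidHom.one_apply]
    intro h
    have h'' := Units.ext_iff.1 h
    rw [Units.val_one, Units.val_neg, Units.val_one] at h''
    norm_num at h''
  have hnotiso : ¬ AreIsomorphicRep (Lf.quot 1) (Lf.quot 0) :=
    not_areIsomorphicRep_quotRep_of_characters ω₁ ω₀ S.scalar_mem_center χ₁.1 (1 : S.normOne →* ℂˣ) Λ 1 hω₁ hω₀ hN₁ hg₀
  -- (1) member by member
  have hItem1 : Lf.Item1AsPrinted := by
    intro i
    fin_cases i
    · exact lemD1_1AsPrinted_of_character_of_rank_ne_two' (Lf.single 0) 1 hω₀ (fun z => rfl)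
        ⟨Set.univ, isOpen_univ, Set.mem_univ _, fun g _ => rfl⟩ hN2
    · exact lemD1_1AsPrinted_of_character_of_rank_ne_two' (Lf.single 1) Λ hω₁ hcen hopen hN2
  -- (3) for all four pairs
  have hrefl : ∀ k : Fin 2, (AreIsomorphicRep (Lf.quot k) (Lf.quot k) ↔
      (Lf.mu k = Lf.mu k ∧ LemD1.SameClass (Lf.eps k) (Lf.eps k) ∧ Lf.chi k = Lf.chi k)) :=
    fun k => iff_of_true ⟨LinearEquiv.refl ℂ _, fun _ _ => rfl⟩ ⟨rfl, ⟨1, by simp⟩, rfl⟩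
  have hItem3 : LemD1_3AsPrintedI Lf := by
    intro _ i j
    fin_cases i <;> fin_cases j
    · exact hrefl 0
    · exact iff_of_false hnotiso fun h => hμne h.1.symm
    · exact iff_of_false (fun h => hnotiso h.symm) fun h => hμne h.1
    · exact hrefl 1
  exact ⟨Lf, rfl, fun _ => rfl, rfl, rfl, hμ₁, hItem1, hItem3, hμne, hχne, hnotiso⟩

include hcδ in
/-- **(1) ∧ (3) JOINTLY, the `χ`-conjunct deciding ALONE, at EVERY place `∤ 2`, `N` odd `≥ 3`**: for every Step-2 element `μ` and
every representative `e`, the two-member collection with labels `(μ, e, 1)`, `(μ, e, χ_Λ)` (same `μ`, same `ε`; `χ_Λ(−1) = −1 ≠ 1`)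
and carriers the trivial line and the line of `Λ` satisfies (1) member by member and (3) for all four pairs — the two `ω`'s are
NON-isomorphic and exactly the `χ`-slot separates the labels (the `χ`-teeth of (3), jointly with (1), at non-split places).
[cite: Liu2021, App. D Lemma D.1 (1) and (3) (l. 5229, 5233)] -/
theorem exists_lemD1IndexedFamily_item1_and_lemD1_3_chi (w : PlacesOver E v) (h2 : (2 : 𝓞 E) ∉ w.1.asIdeal) (hNo : Odd N)
    (h3 : 3 ≤ N) (μ : LemD1.MuSet (LemD1OfPlace.standingData E v c N J hcδ hδ hN hJh hJdet))
    (e : LemD1.EpsRep (LemD1OfPlace.standingData E v c N J hcδ hδ hN hJh hJdet)) :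
    ∃ Lf : LemD1IndexedFamily (v.adicCompletion F) (LocalRing E v) N (Fin 2),
      Lf.S = LemD1OfPlace.standingData E v c N J hcδ hδ hN hJh hJdet ∧
      (∀ i, (Lf.eps i).1 = e.1) ∧ (∀ i, (Lf.mu i).1 = μ.1) ∧ (Lf.chi 0).1 = 1 ∧
      Lf.Item1AsPrinted ∧ LemD1_3AsPrintedI Lf ∧ Lf.mu 0 = Lf.mu 1 ∧ Lf.chi 0 ≠ Lf.chi 1 ∧
      ¬ AreIsomorphicRep (Lf.quot 1) (Lf.quot 0) := by
  classical
  obtain ⟨e₁, he₁⟩ := e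
  have hN2 : N ≠ 2 := by omega
  obtain ⟨Λ, χ₁, hcen, hopen, hΛm1, hχm1⟩ := exists_tame_carrier_character E v c hcδ hδ N J hN hJh hJdet w h2 hNo
  let S := LemD1OfPlace.standingData E v c N J hcδ hδ hN hJh hJdet
  let χ₀ : LemD1.ChiSet S := ⟨1, fun z => by simp, by simpa using continuous_const⟩
  let ω₀ : Representation ℂ S.U ℂ := Representation.trivial ℂ S.U ℂ
  let ω₁ : Representation ℂ S.U ℂ := (DistribMulAction.toModuleEnd ℂ ℂ).comp Λ
  have hω₀ : ∀ (g : S.U) (x : ℂ), ω₀ g x = ((1 : S.U →* ℂˣ) g : ℂ) * x := fun g x => by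
    rw [MonoidHom.one_apply, Units.val_one, one_mul]; rfl
  have hω₁ : ∀ (g : S.U) (x : ℂ), ω₁ g x = (Λ g : ℂ) * x := fun g x => by
    change (Λ g : ℂˣ) • x = _
    rw [Units.smul_def, smul_eq_mul]
  let Lf : LemD1IndexedFamily (v.adicCompletion F) (LocalRing E v) N (Fin 2) :=
    { isNonarchimedeanLocalField := inferInstance
      isModuleTopology := LemD1OfPlace.isModuleTopology_localRing E v
      S := S
      mu := fun _ => μ
      eps := fun _ => ⟨e₁, he₁⟩
      chi := ![χ₀, χ₁]
      V := fun _ => ℂ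
      omega := ![ω₀, ω₁] }
  have hχne : Lf.chi 0 ≠ Lf.chi 1 := fun h => by
    have h' := congrArg (fun χ : LemD1.ChiSet S => χ.1 ⟨-1, neg_one_mem_normOne E v c hcδ hδ N J hN hJh hJdet⟩) h
    change (1 : S.normOne →* ℂˣ) _ = χ₁.1 _ at h'
    rw [MonoidHom.one_apply, hχm1] at h'
    have h'' := Units.ext_iff.1 h'
    rw [Units.val_one, Units.val_neg, Units.val_one] at h''
    norm_num at h''
  have hN₁ : augmentation (Lf.single 1).omega (Lf.single 1).S.scalar (Lf.single 1).chi = ⊥ :=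
    augmentation_eq_bot_of_character (Lf.single 1) Λ hω₁ hcen
  have hg₀ : Λ (S.scalar ⟨-1, neg_one_mem_normOne E v c hcδ hδ N J hN hJh hJdet⟩) ≠
      (1 : S.U →* ℂˣ) (S.scalar ⟨-1, neg_one_mem_normOne E v c hcδ hδ N J hN hJh hJdet⟩) := by
    rw [hΛm1, MonoidHom.one_apply]
    intro h
    have h'' := Units.ext_iff.1 h
    rw [Units.val_one, Units.val_neg, Units.val_one] at h''
    norm_num at h''
  have hnotiso : ¬ AreIsomorphicRep (Lf.quot 1) (Lf.quot 0) :=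
    not_areIsomorphicRep_quotRep_of_characters ω₁ ω₀ S.scalar_mem_center χ₁.1 (1 : S.normOne →* ℂˣ) Λ 1 hω₁ hω₀ hN₁ hg₀
  have hItem1 : Lf.Item1AsPrinted := by
    intro i
    fin_cases i
    · exact lemD1_1AsPrinted_of_character_of_rank_ne_two' (Lf.single 0) 1 hω₀ (fun z => rfl)
        ⟨Set.univ, isOpen_univ, Set.mem_univ _, fun g _ => rfl⟩ hN2
    · exact lemD1_1AsPrinted_of_character_of_rank_ne_two' (Lf.single 1) Λ hω₁ hcen hopen hN2
  have hrefl : ∀ k : Fin 2, (AreIsomorphicRep (Lf.quot k) (Lf.quot k) ↔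
      (Lf.mu k = Lf.mu k ∧ LemD1.SameClass (Lf.eps k) (Lf.eps k) ∧ Lf.chi k = Lf.chi k)) :=
    fun k => iff_of_true ⟨LinearEquiv.refl ℂ _, fun _ _ => rfl⟩ ⟨rfl, ⟨1, by simp⟩, rfl⟩
  have hItem3 : LemD1_3AsPrintedI Lf := by
    intro _ i j
    fin_cases i <;> fin_cases j
    · exact hrefl 0
    · exact iff_of_false hnotiso fun h => hχne h.2.2.symm
    · exact iff_of_false (fun h => hnotiso h.symm) fun h => hχne h.2.2
    · exact hrefl 1
  exact ⟨Lf, rfl, fun _ => rfl, fun _ => rfl, rfl, hItem1, hItem3, rfl, hχne, hnotiso⟩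

include hcδ in
/-- **Consequence** (every place `∤ 2` carrying a Step-2 datum, `N` odd `≥ 3`): the two displayed records read on an indexed collection
over the place model do NOT by their shape force «all members carry the same Step-2 character `μ`» (so a conclusion `μ_i = μ_j` drawn
from them downstream is not vacuous-by-collapse there) — in the tree so far only at SPLIT places
(`LemD1IndexedNonVacuityAtPlace.not_forall_mu_eq_of_split`). [cite: Liu2021, App. D Lemma D.1 (1) and (3) (l. 5229, 5233)] -/
theorem not_forall_mu_eq_twist (w : PlacesOver E v) (h2 : (2 : 𝓞 E) ∉ w.1.asIdeal) (hNo : Odd N) (h3 : 3 ≤ N)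
    (hμ : Nonempty (LemD1.MuSet (LemD1OfPlace.standingData E v c N J hcδ hδ hN hJh hJdet))) :
    ¬ ∀ Lf : LemD1IndexedFamily (v.adicCompletion F) (LocalRing E v) N (Fin 2),
        Lf.S = LemD1OfPlace.standingData E v c N J hcδ hδ hN hJh hJdet →
        Lf.Item1AsPrinted → LemD1_3AsPrintedI Lf → ∀ i j : Fin 2, Lf.mu i = Lf.mu j := by
  obtain ⟨μ⟩ := hμ
  intro h
  obtain ⟨Lf, hS, -, -, -, -, h1, h3', hne, -, -⟩ := exists_lemD1IndexedFamily_item1_and_lemD1_3_twist E v c hcδ hδ N J hN hJh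
    hJdet w h2 hNo h3 μ (LemD1OfPlace.epsDelta E v c N J hcδ hδ hN hJh hJdet)
  exact hne (h Lf hS h1 h3' 0 1)

include hcδ in
/-- **at an inert place `∤ 2` of ANY quadratic `E/F`, with NO input datum** (`N` odd `≥ 3`): the joint certificate on the unramified
sign character of `LemD1IndexedNonVacuityInertSign` and its tame twist — (1) ∧ (3) hold and the two μ-labels differ.
[cite: Liu2021, App. D Lemma D.1 (1) and (3) (l. 5229, 5233)] -/
theorem not_forall_mu_eq_of_inertWitness (w : PlacesOver E v) (hw : c • w.1 = w.1) (h2 : (2 : 𝓞 E) ∉ w.1.asIdeal)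
    (π : (v.adicCompletion F)ˣ) (hπ : Valued.v (toPlace v w (π : v.adicCompletion F)) = WithZero.exp (-1 : ℤ))
    (hNo : Odd N) (h3 : 3 ≤ N) :
    ¬ ∀ Lf : LemD1IndexedFamily (v.adicCompletion F) (LocalRing E v) N (Fin 2),
        Lf.S = LemD1OfPlace.standingData E v c N J hcδ hδ hN hJh hJdet →
        Lf.Item1AsPrinted → LemD1_3AsPrintedI Lf → ∀ i j : Fin 2, Lf.mu i = Lf.mu j := by
  obtain ⟨μ₀, -, -⟩ := LemD1IndexedNonVacuityInertSign.exists_muSet_of_inertWitness E v c hcδ hδ N J hN hJh hJdet w hw π hπ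
  exact not_forall_mu_eq_twist E v c hcδ hδ N J hN hJh hJdet w h2 hNo h3 ⟨μ₀⟩

end PlaceModel

/-! ## §4 The CM rows: the joint certificates with the rows' OWN μ-slot as member `0`, at every place `v ∤ 2` of `L⁺`, `N` odd `≥ 3` -/

section CM

open Literature.NumberTheory.GelbartRogawski1991.UnitaryDualPair (imagUnit complexConj_imagUnit imagUnit_ne_zero)
open Literature.NumberTheory.GelbartRogawski1991.UnitaryDualPair.LocalSplitting (localMu norm_localMu continuous_localMu
  localMu_toLocalRing_eq_one_iff)
open Literature.NumberTheory.Automorphic.IdeleClassGroup (toHeckeCharacter isUnitary_toHeckeCharacter IsConjugateSymplectic)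
open Literature.RepresentationTheory.Liu2021 (isOscillatorChar_toHeckeCharacter_iff)

variable (L : Type) [Field L] [NumberField L] [IsCMField L]

local notation3 "cc" => (IsCMField.complexConj L)
local notation3 "L⁺" => (↥(maximalRealSubfield L))

variable (v : HeightOneSpectrum (𝓞 (maximalRealSubfield L))) (N : ℕ) (J : Matrix (Fin N) (Fin N) L) (hN : 2 ≤ N)
  (hJh : (J.map (IsCMField.complexConj L))ᵀ = J) (hJdet : J.det ≠ 0)

/-- **the joint certificate with the rows' OWN `μ_v` as member `0`** (every `v ∤ 2` of `L⁺` — split, inert or ramified —, `N` odd `≥ 3`,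
every conjugate symplectic `ψ`): labels `(μ_v, ε, 1)`, `(μ', ε, χ_Λ)` with `μ_v = localMu L (toHeckeCharacter L ψ) v` packaged by
`LemD1OfPlace.muOf` with VERBATIM the displayed proofs and `μ'(ε) = −μ_v(ε)`; carriers the trivial line and the tame carrier line; (1)
member by member AND (3) for all four pairs; `Lf.mu 0 ≠ Lf.mu 1`; the `ω`'s non-isomorphic.
[cite: Liu2021, App. D Lemma D.1 (1) and (3) (l. 5229, 5233); Def. 4.11 (l. 2086)] -/
theorem exists_lemD1IndexedFamily_item1_and_lemD1_3_localMu_twist (h2 : (2 : 𝓞 L⁺) ∉ v.asIdeal) (hNo : Odd N) (h3 : 3 ≤ N)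
    (ψ : IdeleClassGroup L →ₜ* Circle) (hψ : IsConjugateSymplectic L ψ) :
    ∃ Lf : LemD1IndexedFamily (v.adicCompletion L⁺) (LocalRing L v) N (Fin 2),
      Lf.S = LemD1OfPlace.standingData L v cc N J (complexConj_imagUnit L) (imagUnit_ne_zero L) hN hJh hJdet ∧
      (∀ i, (Lf.eps i).1 = LemD1OfPlace.eps L v (imagUnit_ne_zero L)) ∧ (Lf.chi 0).1 = 1 ∧
      (Lf.mu 0).1 = localMu L (toHeckeCharacter L ψ) v ∧
      (Lf.mu 1).1 (LemD1OfPlace.eps L v (imagUnit_ne_zero L)) =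
        -localMu L (toHeckeCharacter L ψ) v (LemD1OfPlace.eps L v (imagUnit_ne_zero L)) ∧
      Lf.Item1AsPrinted ∧ LemD1_3AsPrintedI Lf ∧ Lf.mu 0 ≠ Lf.mu 1 ∧ Lf.chi 0 ≠ Lf.chi 1 ∧
      ¬ AreIsomorphicRep (Lf.quot 1) (Lf.quot 0) := by
  obtain ⟨w⟩ := (inferInstance : Nonempty (PlacesOver L v))
  exact exists_lemD1IndexedFamily_item1_and_lemD1_3_twist L v cc (complexConj_imagUnit L) (imagUnit_ne_zero L) N J hN hJh hJdet w
    (LemD1IndexedNonVacuityTameTwist.two_not_mem_of_placesOver L v w h2) hNo h3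
    (LemD1OfPlace.muOf L v cc N J (complexConj_imagUnit L) (imagUnit_ne_zero L) hN hJh hJdet
      (localMu L (toHeckeCharacter L ψ) v)
      (fun x => norm_localMu L (toHeckeCharacter L ψ) v (isUnitary_toHeckeCharacter L ψ) x)
      (continuous_localMu L (toHeckeCharacter L ψ) v)
      (fun t => localMu_toLocalRing_eq_one_iff L (toHeckeCharacter L ψ) v
        ((isOscillatorChar_toHeckeCharacter_iff ψ).mpr hψ) t))
    (LemD1OfPlace.epsDelta L v cc N J (complexConj_imagUnit L) (imagUnit_ne_zero L) hN hJh hJdet)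

/-- **the `χ`-alone joint certificate with the rows' OWN `μ_v` at BOTH members** (every `v ∤ 2` of `L⁺`, `N` odd `≥ 3`): labels
`(μ_v, ε, 1)`, `(μ_v, ε, χ_Λ)`; (1) ∧ (3); `Lf.chi 0 ≠ Lf.chi 1`; non-isomorphic `ω`'s.
[cite: Liu2021, App. D Lemma D.1 (1) and (3) (l. 5229, 5233); Def. 4.11 (l. 2086)] -/
theorem exists_lemD1IndexedFamily_item1_and_lemD1_3_localMu_chi (h2 : (2 : 𝓞 L⁺) ∉ v.asIdeal) (hNo : Odd N) (h3 : 3 ≤ N)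
    (ψ : IdeleClassGroup L →ₜ* Circle) (hψ : IsConjugateSymplectic L ψ) :
    ∃ Lf : LemD1IndexedFamily (v.adicCompletion L⁺) (LocalRing L v) N (Fin 2),
      Lf.S = LemD1OfPlace.standingData L v cc N J (complexConj_imagUnit L) (imagUnit_ne_zero L) hN hJh hJdet ∧
      (∀ i, (Lf.eps i).1 = LemD1OfPlace.eps L v (imagUnit_ne_zero L)) ∧
      (∀ i, (Lf.mu i).1 = localMu L (toHeckeCharacter L ψ) v) ∧ (Lf.chi 0).1 = 1 ∧
      Lf.Item1AsPrinted ∧ LemD1_3AsPrintedI Lf ∧ Lf.mu 0 = Lf.mu 1 ∧ Lf.chi 0 ≠ Lf.chi 1 ∧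
      ¬ AreIsomorphicRep (Lf.quot 1) (Lf.quot 0) := by
  obtain ⟨w⟩ := (inferInstance : Nonempty (PlacesOver L v))
  exact exists_lemD1IndexedFamily_item1_and_lemD1_3_chi L v cc (complexConj_imagUnit L) (imagUnit_ne_zero L) N J hN hJh hJdet w
    (LemD1IndexedNonVacuityTameTwist.two_not_mem_of_placesOver L v w h2) hNo h3
    (LemD1OfPlace.muOf L v cc N J (complexConj_imagUnit L) (imagUnit_ne_zero L) hN hJh hJdet
      (localMu L (toHeckeCharacter L ψ) v)
      (fun x => norm_localMu L (toHeckeCharacter L ψ) v (isUnitary_toHeckeCharacter L ψ) x)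
      (continuous_localMu L (toHeckeCharacter L ψ) v)
      (fun t => localMu_toLocalRing_eq_one_iff L (toHeckeCharacter L ψ) v
        ((isOscillatorChar_toHeckeCharacter_iff ψ).mpr hψ) t))
    (LemD1OfPlace.epsDelta L v cc N J (complexConj_imagUnit L) (imagUnit_ne_zero L) hN hJh hJdet)

/-- **the records `hD1''` ∕ `hD3` read at the rows' slot types do not force «all members carry the same `μ`», at ANY place `v ∤ 2` of
`L⁺`** (`N` odd `≥ 3`) — the non-split places included. [cite: Liu2021, App. D Lemma D.1 (1) and (3) (l. 5229, 5233)] -/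
theorem not_forall_mu_eq_of_isCMField (h2 : (2 : 𝓞 L⁺) ∉ v.asIdeal) (hNo : Odd N) (h3 : 3 ≤ N) :
    ¬ ∀ Lf : LemD1IndexedFamily (v.adicCompletion L⁺) (LocalRing L v) N (Fin 2),
        Lf.S = LemD1OfPlace.standingData L v cc N J (complexConj_imagUnit L) (imagUnit_ne_zero L) hN hJh hJdet →
        Lf.Item1AsPrinted → LemD1_3AsPrintedI Lf → ∀ i j : Fin 2, Lf.mu i = Lf.mu j := by
  obtain ⟨w⟩ := (inferInstance : Nonempty (PlacesOver L v))
  exact not_forall_mu_eq_twist L v cc (complexConj_imagUnit L) (imagUnit_ne_zero L) N J hN hJh hJdet w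
    (LemD1IndexedNonVacuityTameTwist.two_not_mem_of_placesOver L v w h2) hNo h3
    (LemD1IndexedNonVacuityNonsplitPlace.nonempty_muSet_of_isCMField L v N J hN hJh hJdet)

end CM

end Literature.NumberTheory.Automorphic.Liu2021.LemD1IndexedNonVacuityTameCarrier

end
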